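import Summits.BirchSwinnertonDyer.BirchSwinnertonDyer.Theorems.GenusKolyvaginAtTwoGenusPrimitiveSupplyAtTwoTwinSupplyDuality
import Summits.BirchSwinnertonDyer.BirchSwinnertonDyer.Theorems.GenusKolyvaginAtTwoGenusPrimitiveSupplyAtTwoTwinSupplyEll
import HarnessLib

/-!
# R-128 retype — print-form twins of `GenusKolyvaginAtTwoGenusPrimitiveSupplyAtTwoTwinSupplyDuality`

Seat `bsd-line-gk2-p2` g21 (cell `bsd-f1-sign2`), route `GenusKolyvaginAtTwo`, `--supports stmt-BirchSwinnertonDyer-22136`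
(helper; closes nothing). Director-bsd R-128 RETYPE ORDER (2026-08-29 17:42Z; bsd-cited U-r05-BX, T-Q381-1′): the theorems
`minimalSelmerTwinSupply_of_loweringW'`, `minimalSelmerTwinSupply_of_duality'`, `stub_minimalTwinSupplyAtTwo_of_duality_of_twoConverse'`, 
of `Summits.BirchSwinnertonDyer.BirchSwinnertonDyer.Theorems.GenusKolyvaginAtTwoGenusPrimitiveSupplyAtTwoTwinSupplyDuality` take the BARE closure
`∀ V : WeierstrassCurve ℚ, p_parity V 2` (all Weierstrass cubics, singular included — off print and undischargeable by any
faithful Dokchitser–Dokchitser discharge). This file declares their PRIMED TWINS with the hypothesis in print form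
`∀ (V : WeierstrassCurve ℚ) [V.IsElliptic], p_parity V 2` (= route item `TwoParityDD` since rev 34); statements and proofs are
otherwise identical (every application `hpar W` is at an elliptic curve), calls to other retyped theorems go to their twins.
The tree is append-only, so the originals stay (superseded); the file is over the 400-line budget of the original, hence separate.
THEOREMS ONLY; no definition, no named fact, no `sorry`. BSD is NOT proved by any of this; nothing is closed.
-/

set_option linter.dupNamespace false -- tree convention: `Summit.BirchSwinnertonDyer.BirchSwinnertonDyer.Theorems` (summit = sub-problem)
set_option autoImplicit false

noncomputable section

open scoped AddSubgroup

namespace Summit.BirchSwinnertonDyer.BirchSwinnertonDyer.Theorems.GenusKolyLowering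

open NumberField WeierstrassCurve IsDedekindDomain Literature.NumberTheory.EllipticCurves
  Literature.NumberTheory.EllipticCurves.ModularForms Literature.NumberTheory.QuadraticFields
  Literature.NumberTheory.GaloisRepresentations Literature.NumberTheory.GaloisCohomology
open Summit.BirchSwinnertonDyer.BirchSwinnertonDyer.Theorems.GenusKoly

/-! ## R-128 retype (director-bsd 2026-08-29 17:42Z, T-Q381-1′; seat bsd-line-gk2-p2 g21): PRINT-FORM TWINS
Every theorem below is the byte-identical twin of the theorem of the same name without the trailing prime, with the ONE change
that the `2`-parity hypothesis is typed as print has it — `∀ (V : WeierstrassCurve ℚ) [V.IsElliptic], p_parity V 2`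
(Dokchitser–Dokchitser 2010 Thm. 1.4, elliptic curves; = route item `TwoParityDD` after rev 34) — instead of the bare closure
`∀ V : WeierstrassCurve ℚ, p_parity V 2` over all Weierstrass cubics (singular ones included: off print, undischargeable).
Calls to other retyped theorems go to their primed twins; every application `hpar W` is at an elliptic curve, so the proofs are
unchanged. The unprimed originals are kept (append-only tree) and are superseded by these. BSD is NOT proved by any of this. -/


/-- **R-128 retype** (director-bsd 2026-08-29, T-Q381-1′) of `minimalSelmerTwinSupply_of_loweringW`: the SAME statement and proof with the `2`-parity hypothesis in PRINT form `∀ (V : WeierstrassCurve ℚ) [V.IsElliptic], p_parity V 2` (Dokchitser–Dokchitser 2010 Thm. 1.4 is about elliptic curves; the bare closure over all Weierstrass cubics was off print). **(SUPPLY) ⟸ lowering for the twists of `W` + Modularity + `2`-parity + Cassels–Tate** — gk2-p5's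
`GenusKoly.minimalSelmerTwinSupply_of_lowering'` (p591445) VERBATIM with `hMR` replaced by the per-curve hypothesis `hMRW`
(only its instances at twists of the habitat curve are used). See that theorem's docstring for the construction (prime
`q₀ ≡ 7 (mod 8)`, `≡ −1 (mod q ∣ N)`, `> |Δ|`; Heegner twin of odd `2`-Selmer rank; the walk with modulus `8 q₀ N`; the field
`ℚ(√(−q₀u))`). [cite: MazurRubin2010, Prop. 5.2 (proof) with Lemma 3.6] [cite: DokchitserDokchitserAnnals2010, Thm. 1.4]
[cite: GrossLMS1991, §1 (p. 235)] -/
theorem minimalSelmerTwinSupply_of_loweringW' (hmod : exists_isNewformOf)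
    (hpar : ∀ (V : WeierstrassCurve ℚ) [V.IsElliptic], p_parity V 2) (hCT : exists_casselsTate_pairing (K := ℚ))
    (W : WeierstrassCurve ℚ) [W.IsElliptic] [W.IsGloballyMinimal] [NeZero (W.conductorNorm ℤ)]
    (hMRW : ∀ {d : ℚ}, d ≠ 0 → ∀ (V : WeierstrassCurve ℚ) [V.IsElliptic] [V.IsGloballyMinimal],
      (∃ C : VariableChange ℚ, C • W.quadraticTwist d = V) →
      ∀ s : ℕ, Nat.card (V.selmerGroup 2) = 2 ^ s → 1 < s → ∀ m : ℕ, m ≠ 0 →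
        ∃ p : ℕ, p.Prime ∧ (p : ℤ) ≡ 1 [ZMOD (m : ℤ)] ∧
          Nat.card ((V.quadraticTwist (p : ℚ)).selmerGroup 2) = 2 ^ (s - 2))
    (hr0 : W.analyticRank = 0) (hρ : ∀ n : ℕ, 0 < n → W.HasSurjectiveModNGaloisRep ((2 : ℤ) ^ n)) :
    ∃ (K : Type) (_ : Field K) (_ : NumberField K),
      IsImaginaryQuadratic K ∧ Odd (NumberField.discr K) ∧ NumberField.discr K ≠ -3 ∧
      SatisfiesHeegnerHypothesis (W.conductorNorm ℤ) K ∧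
      ¬ IsSquare ((NumberField.discr K : ℚ) * -|W.Δ|) ∧ ¬ IsSquare ((NumberField.discr K : ℚ) * (-(2 * |W.Δ|))) ∧
      ∃ (Wd : WeierstrassCurve ℚ) (_ : Wd.IsElliptic) (_ : Wd.IsGloballyMinimal),
        (∃ C : WeierstrassCurve.VariableChange ℚ, C • W.quadraticTwist (NumberField.discr K : ℚ) = Wd) ∧
        Nat.card (Wd.selmerGroup 2) = 2 := by
  have hN0 : (W.conductorNorm ℤ : ℕ) ≠ 0 := NeZero.ne _
  have hΔ : W.Δ ≠ 0 := W.isUnit_Δ.ne_zero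
  -- Step 1: the auxiliary prime `q₀` and `K₀ = ℚ(√-q₀)`
  obtain ⟨q₀, K₀, _, _, hq₀, hq₀n, hq₀8, hq₀mod, h2K₀, hdiscK₀⟩ :=
    Quadratic.exists_prime_and_field_discr_eq_neg (W.conductorNorm ℤ : ℕ).primeFactors (max W.Δ.num.natAbs W.Δ.den)
  haveI : Fact q₀.Prime := ⟨hq₀⟩
  have hq₀Z : ∀ p : ℕ, p.Prime → p ∣ (W.conductorNorm ℤ : ℕ) → (q₀ : ZMod p) = -1 := fun p hp hpN ↦
    hq₀mod p (Nat.mem_primeFactors.mpr ⟨hp, hpN, hN0⟩) hp.ne_zero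
  have hK₀ : IsImaginaryQuadratic K₀ :=
    ⟨h2K₀, Quadratic.isTotallyComplex_of_discr_neg h2K₀ (by rw [hdiscK₀, neg_lt_zero]; exact_mod_cast hq₀.pos)⟩
  have hH₀ : SatisfiesHeegnerHypothesis (W.conductorNorm ℤ) K₀ := by
    refine satisfiesHeegnerHypothesis_of_discr_congr h2K₀ _ hdiscK₀ (by omega) fun p hp hpN hp2 ↦ ?_
    rw [Int.cast_neg, Int.cast_natCast, hq₀Z p hp hpN, neg_neg]
  -- Step 2: a globally minimal model `W₀` of `W^{(-q₀)}` and its odd `2`-Selmer rank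
  have hd₀ : (NumberField.discr K₀ : ℚ) ≠ 0 := by exact_mod_cast NumberField.discr_ne_zero K₀
  haveI := W.isElliptic_quadraticTwist hd₀
  obtain ⟨C₀, hC₀⟩ := hasGlobalMinimalModel_rat_holds (W.quadraticTwist (NumberField.discr K₀ : ℚ))
  haveI := hC₀
  obtain ⟨k, hk⟩ := exists_card_selmerGroup_twin_eq_two_pow_odd' hmod hpar hCT W hr0 (hρ 1 one_pos) K₀ hK₀ hH₀
    (C₀ • W.quadraticTwist (NumberField.discr K₀ : ℚ)) ⟨C₀, rfl⟩
  -- Step 3: the walk, modulus `m = 8 q₀ N`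
  have hm : 8 * q₀ * (W.conductorNorm ℤ : ℕ) ≠ 0 := mul_ne_zero (mul_ne_zero (by norm_num) hq₀.ne_zero) hN0
  obtain ⟨u, hu, hum, Wd, _, _, hWd, hSel⟩ := exists_twist_card_selmerGroup_two_of_loweringW W hMRW k hd₀
    (C₀ • W.quadraticTwist (NumberField.discr K₀ : ℚ)) ⟨C₀, rfl⟩ hk _ hm
  have hu0 : u ≠ 0 := hu.ne_zero
  have hu8 : (u : ℤ) ≡ 1 [ZMOD 8] := hum.of_dvd ⟨q₀ * (W.conductorNorm ℤ : ℕ), by push_cast; ring⟩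
  have huq₀ : (u : ℤ) ≡ 1 [ZMOD q₀] := hum.of_dvd ⟨8 * (W.conductorNorm ℤ : ℕ), by push_cast; ring⟩
  have hq₀u : ¬ q₀ ∣ u := by
    intro h
    have hdu : (q₀ : ℤ) ∣ (u : ℤ) := by exact_mod_cast h
    have h1 : (q₀ : ℤ) ∣ 1 := by simpa using Int.dvd_sub hdu (Int.ModEq.dvd huq₀.symm)
    exact hq₀.one_lt.ne' (by exact_mod_cast Int.eq_one_of_dvd_one (by positivity) h1)
  -- Step 4: the field `K = ℚ(√(-q₀ u))`
  set D : ℤ := -((q₀ : ℤ) * u) with hDdef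
  have hD8 : D % 8 = 1 := neg_mul_emod_eight (by exact_mod_cast hq₀8) hu8
  have hDsq : Squarefree D := by
    rw [hDdef, ← Int.squarefree_natAbs]
    have : ((q₀ : ℤ) * u).natAbs = q₀ * u := by
      rw [Int.natAbs_mul, Int.natAbs_natCast, Int.natAbs_natCast]
    rw [Int.natAbs_neg, this]
    exact (Nat.squarefree_mul (hq₀.coprime_iff_not_dvd.mpr hq₀u)).mpr ⟨hq₀.squarefree, hu⟩
  have hq₀7 : 7 ≤ q₀ := by omega
  have hDle : D ≤ -7 := by
    have : (7 : ℤ) * 1 ≤ (q₀ : ℤ) * u :=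
      mul_le_mul (by exact_mod_cast hq₀7) (by exact_mod_cast Nat.one_le_iff_ne_zero.mpr hu0) zero_le_one
        (by positivity)
    omega
  obtain ⟨K, _, _, h2K, hdiscK⟩ := Quadratic.exists_numberField_discr_eq (D := D) (Or.inl ⟨hD8.symm ▸ by omega, hDsq, by omega⟩)
  have hdiscKQ : (NumberField.discr K : ℚ) = (NumberField.discr K₀ : ℚ) * u := by
    rw [hdiscK, hdiscK₀, hDdef]; push_cast; ring
  -- `q₀`-adic valuations: `ord_{q₀}(q₀ · u · |Δ|) = 1`, `ord_{q₀}(2) = 0`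
  have hq₀Q : (q₀ : ℚ) ≠ 0 := by exact_mod_cast hq₀.ne_zero
  have huQ : (u : ℚ) ≠ 0 := by exact_mod_cast hu0
  have hnum : ¬ (q₀ : ℤ) ∣ W.Δ.num := by
    intro h
    have h' : q₀ ∣ W.Δ.num.natAbs := Int.natCast_dvd.mp h
    have hpos : 0 < W.Δ.num.natAbs := Int.natAbs_pos.mpr (Rat.num_ne_zero.mpr hΔ)
    have := Nat.le_of_dvd hpos h'
    omega
  have hden : ¬ q₀ ∣ W.Δ.den := by
    intro h
    have := Nat.le_of_dvd W.Δ.den_pos h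
    omega
  have hvΔ : padicValRat q₀ W.Δ = 0 := by
    simp only [padicValRat, padicValInt.eq_zero_of_not_dvd hnum, padicValNat.eq_zero_of_not_dvd hden]
    simp
  have hvΔabs : padicValRat q₀ |W.Δ| = 0 := by
    rcases abs_choice W.Δ with h | h
    · rw [h, hvΔ]
    · rw [h, padicValRat.neg, hvΔ]
  have hvu : padicValRat q₀ (u : ℚ) = 0 := by
    rw [padicValRat.of_nat, padicValNat.eq_zero_of_not_dvd hq₀u, Nat.cast_zero]
  have hv2 : padicValRat q₀ (2 : ℚ) = 0 := by
    have h2 : ¬ q₀ ∣ 2 := fun h ↦ by have := Nat.le_of_dvd two_pos h; omega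
    rw [show (2 : ℚ) = ((2 : ℕ) : ℚ) by norm_num, padicValRat.of_nat, padicValNat.eq_zero_of_not_dvd h2,
      Nat.cast_zero]
  have hy0 : (q₀ : ℚ) * u * |W.Δ| ≠ 0 := mul_ne_zero (mul_ne_zero hq₀Q huQ) (abs_ne_zero.mpr hΔ)
  have hy : padicValRat q₀ ((q₀ : ℚ) * u * |W.Δ|) = 1 := by
    rw [padicValRat.mul (mul_ne_zero hq₀Q huQ) (abs_ne_zero.mpr hΔ), padicValRat.mul hq₀Q huQ,
      padicValRat.self hq₀.one_lt, hvu, hvΔabs]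
    simp
  refine ⟨K, inferInstance, inferInstance, ?_, ?_, ?_, ?_, ?_, ?_, Wd, inferInstance, inferInstance, ?_, hSel⟩
  · -- imaginary quadratic
    exact ⟨h2K, Quadratic.isTotallyComplex_of_discr_neg h2K (by rw [hdiscK]; omega)⟩
  · -- `d_K` odd
    rw [hdiscK, Int.odd_iff]; omega
  · -- `d_K ≠ -3`
    rw [hdiscK]; omega
  · -- Heegner hypothesis
    refine satisfiesHeegnerHypothesis_of_discr_congr h2K _ hdiscK hD8 fun p hp hpN hp2 ↦ ?_
    have hpm : p ∣ 8 * q₀ * (W.conductorNorm ℤ : ℕ) := hpN.mul_left _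
    have hup : ((u : ℤ) : ZMod p) = ((1 : ℤ) : ZMod p) := Quadratic.intCast_zmod_eq_of_modEq_of_dvd hum hpm
    rw [hDdef, Int.cast_neg, Int.cast_mul, Int.cast_natCast, hq₀Z p hp hpN, hup]
    push_cast; ring
  · -- `d_K · (−|Δ|)` is not a square: its `q₀`-adic valuation is `1`
    have hx : (NumberField.discr K : ℚ) * -|W.Δ| = (q₀ : ℚ) * u * |W.Δ| := by rw [hdiscK, hDdef]; push_cast; ring
    rw [hx]
    exact not_isSquare_of_odd_padicValRat (q := q₀) hy0 (by rw [hy]; exact odd_one)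
  · -- `d_K · (−2|Δ|)` is not a square: its `q₀`-adic valuation is `1`
    have hx : (NumberField.discr K : ℚ) * (-(2 * |W.Δ|)) = 2 * ((q₀ : ℚ) * u * |W.Δ|) := by
      rw [hdiscK, hDdef]; push_cast; ring
    rw [hx]
    refine not_isSquare_of_odd_padicValRat (q := q₀) (mul_ne_zero two_ne_zero hy0) ?_
    rw [padicValRat.mul two_ne_zero hy0, hy, hv2, zero_add]
    exact odd_one
  · -- the twin
    rw [hdiscKQ]
    exact hWd


/-- **R-128 retype** (director-bsd 2026-08-29, T-Q381-1′) of `minimalSelmerTwinSupply_of_duality`: the SAME statement and proof with the `2`-parity hypothesis in PRINT form `∀ (V : WeierstrassCurve ℚ) [V.IsElliptic], p_parity V 2` (Dokchitser–Dokchitser 2010 Thm. 1.4 is about elliptic curves; the bare closure over all Weierstrass cubics was off print). **(SUPPLY) FOR THE HABITAT, MODULO FIVE STANDARD PRINT FACTS — Mazur–Rubin Prop. 5.2 DISCHARGED.** For `W/ℚ` globally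
minimal, non-CM, `r_an(W) = 0`, `ρ_{W,2^n}` onto for all `n ≥ 1`: there are a Kolyvagin-(H2)-admissible Heegner field `K`
(imaginary quadratic, `d_K` odd `≠ −3`, every prime of `N_W` split, `d_K·(−|Δ|)` and `d_K·(−2|Δ|)` non-squares) and a globally
minimal twin `Wd ≅ W^{(d_K)}` with `#Sel₂(Wd) = 2` — GRANTED ONLY Modularity `exists_isNewformOf` (BCDT), the `2`-parity theorem
`p_parity · 2` (Dokchitser–Dokchitser / Monsky), the Cassels–Tate pairing `exists_casselsTate_pairing`, Poitou–Tate duality with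
real places `poitouTate_selmerStructure_duality_real ℚ` (Milne ADT I.4.10) and Tate's local Euler characteristic
`localEulerPoincareCharacteristic`. Compared with p591445 (`…_of_lowering`) the Mazur–Rubin input `hMR` (`prop52_rat`) is GONE:
it is the lead's kernel theorem `prop52_of_hasSurjectiveModNGaloisRep` (Lemma 3.6 + Čebotarev + the index-4 transfer + Lemma 2.11).
The hypotheses `¬CM` and surjectivity beyond level `2` are idle. BSD is not proved by this.
[cite: MazurRubin2010, Prop. 5.2 (proof, arXiv:0904.3709 p. 12) with Lemma 3.6 and Cor. 3.4 (i)]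
[cite: DokchitserDokchitserAnnals2010, Thm. 1.4] [cite: MilneADT2006, Ch. I, Thm. 4.10] [cite: GrossLMS1991, §1 (p. 235)] -/
theorem minimalSelmerTwinSupply_of_duality' (hmod : exists_isNewformOf)
    (hpar : ∀ (V : WeierstrassCurve ℚ) [V.IsElliptic], p_parity V 2) (hCT : exists_casselsTate_pairing (K := ℚ))
    (hPT : poitouTate_selmerStructure_duality_real ℚ)
    (hEP : ∀ v : HeightOneSpectrum (𝓞 ℚ), localEulerPoincareCharacteristic (v.adicCompletion ℚ)) :
    ∀ (W : WeierstrassCurve ℚ) [W.IsElliptic] [W.IsGloballyMinimal] [NeZero (W.conductorNorm ℤ)],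
      ¬ W.HasCM → W.analyticRank = 0 → (∀ n : ℕ, 0 < n → W.HasSurjectiveModNGaloisRep ((2 : ℤ) ^ n)) →
      ∃ (K : Type) (_ : Field K) (_ : NumberField K),
        IsImaginaryQuadratic K ∧ Odd (NumberField.discr K) ∧ NumberField.discr K ≠ -3 ∧
        SatisfiesHeegnerHypothesis (W.conductorNorm ℤ) K ∧
        ¬ IsSquare ((NumberField.discr K : ℚ) * -|W.Δ|) ∧ ¬ IsSquare ((NumberField.discr K : ℚ) * (-(2 * |W.Δ|))) ∧
        ∃ (Wd : WeierstrassCurve ℚ) (_ : Wd.IsElliptic) (_ : Wd.IsGloballyMinimal),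
          (∃ C : WeierstrassCurve.VariableChange ℚ, C • W.quadraticTwist (NumberField.discr K : ℚ) = Wd) ∧
          Nat.card (Wd.selmerGroup 2) = 2 := by
  intro W _ _ _ _hcm hr0 hρ
  have hsurj : W.HasSurjectiveModNGaloisRep 2 := by simpa using hρ 1 one_pos
  exact minimalSelmerTwinSupply_of_loweringW' hmod hpar hCT W (loweringW_of_duality hPT hEP W hsurj) hr0 hρ


/-- **R-128 retype** (director-bsd 2026-08-29, T-Q381-1′) of `stub_minimalTwinSupplyAtTwo_of_duality_of_twoConverse`: the SAME statement and proof with the `2`-parity hypothesis in PRINT form `∀ (V : WeierstrassCurve ℚ) [V.IsElliptic], p_parity V 2` (Dokchitser–Dokchitser 2010 Thm. 1.4 is about elliptic curves; the bare closure over all Weierstrass cubics was off print). **STUB A ⟸ Modularity ∧ `2`-parity ∧ Cassels–Tate ∧ Poitou–Tate ∧ Tate χ ∧ (CONV₂).** The registered stub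
`stub_minimalTwinSupplyAtTwo` of line `genus-supply` (crux 22136) VERBATIM from five PRINT facts (displayed) and the rank-one
`2`-converse `hconv` (OPEN, crux 19220, here without its reduction-type clause) — gk2-p5's
`stub_minimalTwinSupplyAtTwo_of_lowering_of_twoConverse'` with the Mazur–Rubin lowering step PROVED (`minimalSelmerTwinSupply_of_duality'`
∘ the lead's `stub_minimalTwinSupplyAtTwo_of_twoConverse'`). So stub A's only non-print input is the `2`-converse, and its print
inputs are the cell's five standard named facts. BSD is not proved by any of this.
[cite: MazurRubin2010, Prop. 5.2 (proof) with Lemma 3.6] [cite: DokchitserDokchitserAnnals2010, Thm. 1.4] -/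
theorem stub_minimalTwinSupplyAtTwo_of_duality_of_twoConverse' (hmod : exists_isNewformOf)
    (hpar : ∀ (V : WeierstrassCurve ℚ) [V.IsElliptic], p_parity V 2) (hCT : exists_casselsTate_pairing (K := ℚ))
    (hPT : poitouTate_selmerStructure_duality_real ℚ)
    (hEP : ∀ v : HeightOneSpectrum (𝓞 ℚ), localEulerPoincareCharacteristic (v.adicCompletion ℚ))
    (hconv : ∀ (V : WeierstrassCurve ℚ) [V.IsElliptic] [V.IsGloballyMinimal],
      ¬ V.HasCM → V.selmerCorank 2 = 1 → V.analyticRank = 1) :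
    ∀ (W : WeierstrassCurve ℚ) [W.IsElliptic] [W.IsGloballyMinimal] [NeZero (W.conductorNorm ℤ)],
      ¬ W.HasCM → W.analyticRank = 0 → (∀ n : ℕ, 0 < n → W.HasSurjectiveModNGaloisRep ((2 : ℤ) ^ n)) →
      ∃ (K : Type) (_ : Field K) (_ : NumberField K),
        IsImaginaryQuadratic K ∧ Odd (NumberField.discr K) ∧ NumberField.discr K ≠ -3 ∧
        SatisfiesHeegnerHypothesis (W.conductorNorm ℤ) K ∧
        ¬ IsSquare ((NumberField.discr K : ℚ) * -|W.Δ|) ∧ ¬ IsSquare ((NumberField.discr K : ℚ) * (-(2 * |W.Δ|))) ∧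
        ∃ (Wd : WeierstrassCurve ℚ) (_ : Wd.IsElliptic) (_ : Wd.IsGloballyMinimal),
          (∃ C : WeierstrassCurve.VariableChange ℚ, C • W.quadraticTwist (NumberField.discr K : ℚ) = Wd) ∧
          Wd.analyticRank = 1 ∧ Nat.card (Wd.selmerGroup 2) = 2 :=
  stub_minimalTwinSupplyAtTwo_of_twoConverse' hmod hpar hconv (minimalSelmerTwinSupply_of_duality' hmod hpar hCT hPT hEP)


end Summit.BirchSwinnertonDyer.BirchSwinnertonDyer.Theorems.GenusKolyLowering

end
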